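import Summits.QuantumFields.BalabanUV.Beta.GAN24.DiagramVolumeLimitPairs

/-!
# `BalabanUV.Beta.GAN24.VolumeLimitPairsFibre` — binder row G-an2-4 ∕ (CONV-C), route R7 «TWO CURRENCIES», PART 144: INFINITE-VOLUME ENTRY LIMITS OF INVERSES WITHOUT TRANSLATION INVARIANCE,
# FOR AN ARBITRARY FINITE FIBRE.  PART 137 (`exists_tendsto_inv_kernel`) needs SHIFT-INVARIANT operators on `Site d s × Fin d` (kernels of one variable); backgrounds `U ≠ 1`, local potentials and
# the fine torus seen from the unit lattice (fibre = block offsets × directions) are NOT of that kind.  Here: volume-indexed families `A_t` of matrices on `Site d (side t) × F`, `F` ANY finite type,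
# with (a) `‖1 − τ•A_t‖ ≤ q < 1`, (b) volume-uniform WINDOW DECAY of the entries `‖A_t((w,f),(y,g))‖ ≤ C·e^{−δ|windowMap(w − y)|₁}` and (c) convergence of the entries at every PAIR of integer
# readings (EL₂) have inverses whose entries converge at every pair of integer readings — by PART 142's Tannery over the window (pair products, no shift invariance), induction over the powers
# `(1 − τ•A_t)^i`, and PART 136's Neumann–Tannery lemma.  The socket for the volume limits of `c_k(U)⁻¹`, `Δ_a(U)⁻¹` and of block-fibred fine-torus operators (unit b2b-balaban-gan24-p3, gen 54; v1)

NOT IN PRINT; OUR PROOF ([folklore] bookkeeping BY NAME over PART 142 (`tendsto_sum_window`, `l1_windowMap_sub_castT_ge`), PART 136 (`tendsto_inv_apply_of_tendsto_pow_apply`, `norm_pow_apply_le`),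
`B12Sec2to5.summable_exp_neg_l1`, the β-cell's window dictionary; [Balaban1987RG1] p. 264 (after (1.21)) LOCATES the `T ↗ ℤ^d` limit; nothing printed is a hypothesis).
HONEST FRAMING (cell contract, verbatim): «discharging `BetaPertH` makes Bałaban's UV stability UNCONDITIONAL — a real constructive-QFT result; it is NOT the
continuum limit and NOT the Clay problem.»  HONEST DEPENDENCY (verbatim): «continuum YM on T⁴ ⇐ BetaPertH ∧ nine spine estimates (0/9 proved); BetaPertH ⇐
(D1) ∧ (D4) ∧ CAP+tail; G-an2-4 gates asym, D1 and NE2/3/4.»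

WHAT THIS FILE PROVES (0 sorry, 0 `def`; `F` a finite type, `ẑ_t = castT (cubic d (side t)) z`; EL₂(X_t) ≡ `∀ f g z z′, ∃ s, X_t((ẑ,f),(ẑ′,g)) → s` along `side t → ∞`):
* §1 **`tendsto_mul_pair`** ∕ `tendsto_mul_pair'` — EL₂ OF PRODUCTS on `Site d (side t) × F`: one factor volume-uniformly bounded, the other with volume-uniform window decay (from the right
  site ∕ from the left site), both EL₂ ⟹ EL₂ of the product.
* §2 `windowMap_zero`, `norm_one_sub_smul_apply_le` (window decay of `1 − τ•A` from that of `A`), `tendsto_one_sub_smul_pair` (EL₂ of `1 − τ•A`), **`tendsto_pow_pair`** (EL₂ of every power, by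
  induction with §1 and PART 136's `‖((1 − τ•A)^i) x y‖ ≤ q^i`), **`exists_tendsto_inv_pair`** — THE THEOREM: (a)+(b)+(c) ⟹ EL₂ of `A_t⁻¹`.
WHAT IT DOES NOT DO: verify (a)(b)(c) for any operator of Bałaban's (suppliers: (a) Hermitian sandwich PART 138 §1; (b) Combes–Thomas rows of NE2 ∕ the β-cell; (c) per object); shift-invariant
families are PART 137's special case (there (c) at the origin pairs suffices).  SUPPLIER work; NEVER «G-an2-4 closed»; NOT (CONV-C), NOT D1, NOT `BetaPertH`, NOT continuum, NOT Clay.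
Records: `HOME/b2b-balaban-gan24-p3/gen54/README.md`.
-/

noncomputable section

open scoped BigOperators ComplexConjugate Matrix Matrix.Norms.L2Operator
open Filter Topology

namespace Summit.QuantumFields.BalabanUV.Beta.GAN24.VolumeLimitPairsFibre

open Literature.MathematicalPhysics.QuantumFieldTheory.Balaban1983to89
open Literature.MathematicalPhysics.QuantumFieldTheory.Balaban1983to89.B12Sec2to5 (l1 summable_exp_neg_l1)
open Literature.MathematicalPhysics.QuantumFieldTheory.Balaban1983to89.Beta (Site symmRep windowMap)
open Literature.MathematicalPhysics.QuantumFieldTheory.Balaban1983to89.Beta.FreeLegDictionary (cubic)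
open Literature.MathematicalPhysics.QuantumFieldTheory.Balaban1983to89.Beta.VectorTails (castT castT_add castT_neg)
open Summit.QuantumFields.BalabanUV.Beta.GAN24.VolumeLimitAlgebra (tendsto_inv_apply_of_tendsto_pow_apply norm_pow_apply_le)
open Summit.QuantumFields.BalabanUV.Beta.GAN24.DiagramVolumeLimitPairs (tendsto_sum_window l1_windowMap_sub_castT_ge)

variable {d : ℕ} {F : Type*} [Fintype F] [DecidableEq F] {side : ℕ → ℕ} [∀ t, NeZero (side t)]

/-! ## §1 Pair products on `Site d (side t) × F` -/

omit [DecidableEq F] in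
/-- **`tendsto_mul_pair` — EL₂ OF PRODUCTS, RIGHT FACTOR DECAYING** [folklore]: along `side t → ∞`, `‖X_t((x,f),(w,g))‖ ≤ B`, `‖Y_t((w,g),(y,h))‖ ≤ C·e^{−δ|windowMap(w − y)|₁}` (`δ > 0`), EL₂ of
both ⟹ EL₂ of `X_t·Y_t` (PART 142's Tannery over the window with the majorant `B·C·e^{3δ|z′|₁}·e^{−δ|y|₁}`, one window sum per fibre index). -/
theorem tendsto_mul_pair (hside : Tendsto side atTop atTop) {X Y : (t : ℕ) → Matrix (Site d (side t) × F) (Site d (side t) × F) ℂ} {B C δ : ℝ}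
    (hB : ∀ t (x : Site d (side t)) (f : F) (w : Site d (side t)) (g : F), ‖X t (x, f) (w, g)‖ ≤ B)
    (hdec : ∀ t (w : Site d (side t)) (g : F) (y : Site d (side t)) (h : F), ‖Y t (w, g) (y, h)‖ ≤ C * Real.exp (-δ * l1 (windowMap d (side t) (w - y)))) (hδ : 0 < δ)
    (hX : ∀ (f g : F) (z z' : Fin d → ℤ), ∃ s : ℂ, Tendsto (fun t => X t (castT (cubic d (side t)) z, f) (castT (cubic d (side t)) z', g)) atTop (𝓝 s))
    (hY : ∀ (f g : F) (z z' : Fin d → ℤ), ∃ s : ℂ, Tendsto (fun t => Y t (castT (cubic d (side t)) z, f) (castT (cubic d (side t)) z', g)) atTop (𝓝 s))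
    (f h : F) (z z' : Fin d → ℤ) :
    ∃ s : ℂ, Tendsto (fun t => (X t * Y t) (castT (cubic d (side t)) z, f) (castT (cubic d (side t)) z', h)) atTop (𝓝 s) := by
  classical
  choose P hP using hX
  choose Q hQ using hY
  have hB0 : 0 ≤ B := (norm_nonneg _).trans (hB 0 0 f 0 f)
  have hC0 : 0 ≤ C := by
    have h := hdec 0 0 f 0 f
    exact nonneg_of_mul_nonneg_left ((norm_nonneg _).trans h) (Real.exp_pos _)
  refine ⟨∑ g, ∑' y, P f g z y * Q g h y z', ?_⟩
  have e : ∀ t, (X t * Y t) (castT (cubic d (side t)) z, f) (castT (cubic d (side t)) z', h)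
      = ∑ g : F, ∑ w : Site d (side t), X t (castT (cubic d (side t)) z, f) (w, g) * Y t (w, g) (castT (cubic d (side t)) z', h) := by
    intro t; rw [Matrix.mul_apply, Fintype.sum_prod_type, Finset.sum_comm]
  simp only [e]
  refine tendsto_finsetSum _ fun g _ => ?_
  refine tendsto_sum_window hside (F := fun t w => X t (castT (cubic d (side t)) z, f) (w, g) * Y t (w, g) (castT (cubic d (side t)) z', h))
    (fun y => (hP f g z y).mul (hQ g h y z')) (((summable_exp_neg_l1 hδ d).mul_left (B * C * Real.exp (δ * (3 * l1 z')))))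
    (fun y => by positivity) fun t w => ?_
  rw [norm_mul]
  have h1 := hB t (castT (cubic d (side t)) z) f w g
  have h2 := hdec t w g (castT (cubic d (side t)) z') h
  have h3 := l1_windowMap_sub_castT_ge (side t) w z'
  have h4 : Real.exp (-δ * l1 (windowMap d (side t) (w - castT (cubic d (side t)) z'))) ≤ Real.exp (δ * (3 * l1 z')) * Real.exp (-δ * l1 (windowMap d (side t) w)) := by
    rw [← Real.exp_add]; exact Real.exp_le_exp.mpr (by nlinarith)
  calc ‖X t _ _‖ * ‖Y t _ _‖ ≤ B * (C * Real.exp (-δ * l1 (windowMap d (side t) (w - castT (cubic d (side t)) z')))) := mul_le_mul h1 h2 (norm_nonneg _) hB0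
    _ ≤ B * (C * (Real.exp (δ * (3 * l1 z')) * Real.exp (-δ * l1 (windowMap d (side t) w)))) := by gcongr
    _ = B * C * Real.exp (δ * (3 * l1 z')) * Real.exp (-δ * l1 (windowMap d (side t) w)) := by ring

omit [DecidableEq F] in
/-- **`tendsto_mul_pair'` — EL₂ OF PRODUCTS, LEFT FACTOR DECAYING** [folklore]: `‖X_t((x,f),(w,g))‖ ≤ C·e^{−δ|windowMap(w − x)|₁}`, `‖Y_t((w,g),(y,h))‖ ≤ B`. -/
theorem tendsto_mul_pair' (hside : Tendsto side atTop atTop) {X Y : (t : ℕ) → Matrix (Site d (side t) × F) (Site d (side t) × F) ℂ} {B C δ : ℝ}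
    (hdec : ∀ t (x : Site d (side t)) (f : F) (w : Site d (side t)) (g : F), ‖X t (x, f) (w, g)‖ ≤ C * Real.exp (-δ * l1 (windowMap d (side t) (w - x)))) (hδ : 0 < δ)
    (hB : ∀ t (w : Site d (side t)) (g : F) (y : Site d (side t)) (h : F), ‖Y t (w, g) (y, h)‖ ≤ B)
    (hX : ∀ (f g : F) (z z' : Fin d → ℤ), ∃ s : ℂ, Tendsto (fun t => X t (castT (cubic d (side t)) z, f) (castT (cubic d (side t)) z', g)) atTop (𝓝 s))
    (hY : ∀ (f g : F) (z z' : Fin d → ℤ), ∃ s : ℂ, Tendsto (fun t => Y t (castT (cubic d (side t)) z, f) (castT (cubic d (side t)) z', g)) atTop (𝓝 s))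
    (f h : F) (z z' : Fin d → ℤ) :
    ∃ s : ℂ, Tendsto (fun t => (X t * Y t) (castT (cubic d (side t)) z, f) (castT (cubic d (side t)) z', h)) atTop (𝓝 s) := by
  classical
  choose P hP using hX
  choose Q hQ using hY
  have hB0 : 0 ≤ B := (norm_nonneg _).trans (hB 0 0 f 0 f)
  have hC0 : 0 ≤ C := by
    have h := hdec 0 0 f 0 f
    exact nonneg_of_mul_nonneg_left ((norm_nonneg _).trans h) (Real.exp_pos _)
  refine ⟨∑ g, ∑' y, P f g z y * Q g h y z', ?_⟩
  have e : ∀ t, (X t * Y t) (castT (cubic d (side t)) z, f) (castT (cubic d (side t)) z', h)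
      = ∑ g : F, ∑ w : Site d (side t), X t (castT (cubic d (side t)) z, f) (w, g) * Y t (w, g) (castT (cubic d (side t)) z', h) := by
    intro t; rw [Matrix.mul_apply, Fintype.sum_prod_type, Finset.sum_comm]
  simp only [e]
  refine tendsto_finsetSum _ fun g _ => ?_
  refine tendsto_sum_window hside (F := fun t w => X t (castT (cubic d (side t)) z, f) (w, g) * Y t (w, g) (castT (cubic d (side t)) z', h))
    (fun y => (hP f g z y).mul (hQ g h y z')) (((summable_exp_neg_l1 hδ d).mul_left (C * B * Real.exp (δ * (3 * l1 z)))))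
    (fun y => by positivity) fun t w => ?_
  rw [norm_mul]
  have h1 := hdec t (castT (cubic d (side t)) z) f w g
  have h2 := hB t w g (castT (cubic d (side t)) z') h
  have h3 := l1_windowMap_sub_castT_ge (side t) w z
  have h4 : Real.exp (-δ * l1 (windowMap d (side t) (w - castT (cubic d (side t)) z))) ≤ Real.exp (δ * (3 * l1 z)) * Real.exp (-δ * l1 (windowMap d (side t) w)) := by
    rw [← Real.exp_add]; exact Real.exp_le_exp.mpr (by nlinarith)
  calc ‖X t _ _‖ * ‖Y t _ _‖ ≤ (C * Real.exp (-δ * l1 (windowMap d (side t) (w - castT (cubic d (side t)) z)))) * B := mul_le_mul h1 h2 (norm_nonneg _) (by positivity)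
    _ ≤ (C * (Real.exp (δ * (3 * l1 z)) * Real.exp (-δ * l1 (windowMap d (side t) w)))) * B := by gcongr
    _ = C * B * Real.exp (δ * (3 * l1 z)) * Real.exp (-δ * l1 (windowMap d (side t) w)) := by ring

/-! ## §2 Powers and the inverse -/

omit [∀ t, NeZero (side t)] in
/-- `windowMap 0 = 0`. [folklore] -/
theorem windowMap_zero (s : ℕ) [NeZero s] : windowMap d s (0 : Site d s) = 0 := by
  funext i
  simp [windowMap, symmRep]

omit [Fintype F] [∀ t, NeZero (side t)] in
/-- window decay of `1 − τ•A` from that of `A`: `‖(1 − τ•A)((w,g),(y,h))‖ ≤ (1 + ‖τ‖C)·e^{−δ|windowMap(w − y)|₁}` (the unit kernel is supported on the diagonal). [folklore] -/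
theorem norm_one_sub_smul_apply_le (s : ℕ) [NeZero s] {A : Matrix (Site d s × F) (Site d s × F) ℂ} {C δ : ℝ} (τ : ℂ)
    (hdec : ∀ (w : Site d s) (g : F) (y : Site d s) (h : F), ‖A (w, g) (y, h)‖ ≤ C * Real.exp (-δ * l1 (windowMap d s (w - y))))
    (w : Site d s) (g : F) (y : Site d s) (h : F) :
    ‖(1 - τ • A) (w, g) (y, h)‖ ≤ (1 + ‖τ‖ * C) * Real.exp (-δ * l1 (windowMap d s (w - y))) := by
  rw [Matrix.sub_apply, Matrix.smul_apply, smul_eq_mul]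
  refine (norm_sub_le _ _).trans ?_
  rw [norm_mul, add_mul, one_mul, mul_assoc]
  refine add_le_add ?_ (mul_le_mul_of_nonneg_left (hdec w g y h) (norm_nonneg τ))
  by_cases hwy : (w, g) = (y, h)
  · obtain ⟨rfl, rfl⟩ := Prod.mk.injEq _ _ _ _ ▸ hwy
    rw [Matrix.one_apply_eq, norm_one, sub_self, windowMap_zero]
    simp [l1]
  · rw [Matrix.one_apply_ne hwy, norm_zero]; positivity

omit [Fintype F] in
/-- EL₂ of `1 − τ•A` from EL₂ of `A` (the unit kernel at integer pairs is eventually the constant `[z = z′]·[f = g]`, PART 142 ∕ 140 style). [folklore] -/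
theorem tendsto_one_sub_smul_pair (hside : Tendsto side atTop atTop) {A : (t : ℕ) → Matrix (Site d (side t) × F) (Site d (side t) × F) ℂ} (τ : ℂ)
    (hA : ∀ (f g : F) (z z' : Fin d → ℤ), ∃ s : ℂ, Tendsto (fun t => A t (castT (cubic d (side t)) z, f) (castT (cubic d (side t)) z', g)) atTop (𝓝 s))
    (f g : F) (z z' : Fin d → ℤ) :
    ∃ s : ℂ, Tendsto (fun t => (1 - τ • A t) (castT (cubic d (side t)) z, f) (castT (cubic d (side t)) z', g)) atTop (𝓝 s) := by
  obtain ⟨s, hs⟩ := hA f g z z'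
  have h1 : Tendsto (fun t => (1 : Matrix (Site d (side t) × F) (Site d (side t) × F) ℂ) (castT (cubic d (side t)) z, f) (castT (cubic d (side t)) z', g)) atTop
      (𝓝 (if z = z' ∧ f = g then 1 else 0)) := by
    refine Tendsto.congr' ?_ tendsto_const_nhds
    have hev : ∀ᶠ t : ℕ in atTop, ((fun i : Fin d => (((z - z') i : ℤ) : ZMod (side t))) = (0 : Site d (side t))) ↔ z - z' = 0 := by
      filter_upwards [Beta.eventually_inWindow hside (z - z'), Beta.eventually_inWindow hside 0] with t hx h0
      constructor
      · intro h
        have e1 : windowMap d (side t) (Beta.siteOf d (side t) (z - z')) = z - z' := Beta.windowMap_siteOf d (side t) hx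
        have e2 : Beta.siteOf d (side t) (z - z') = Beta.siteOf d (side t) 0 := by
          funext i; have := congrFun h i; simpa [Beta.siteOf] using this
        rw [e2, Beta.windowMap_siteOf d (side t) h0] at e1
        exact e1.symm
      · intro h; rw [h]; funext i; simp
    filter_upwards [hev] with t ht
    have ec : castT (cubic d (side t)) z = castT (cubic d (side t)) z' ↔ z = z' := by
      rw [← sub_eq_zero, ← sub_eq_zero (a := z)]
      have : castT (cubic d (side t)) z - castT (cubic d (side t)) z' = castT (cubic d (side t)) (z - z') := by
        rw [sub_eq_add_neg, sub_eq_add_neg, castT_add, castT_neg]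
      rw [this]; exact ht
    simp only [Matrix.one_apply, Prod.mk.injEq, ec]
  refine ⟨(if z = z' ∧ f = g then 1 else 0) - τ * s, ?_⟩
  simp only [Matrix.sub_apply, Matrix.smul_apply, smul_eq_mul]
  exact h1.sub (hs.const_mul τ)

/-- **`tendsto_pow_pair` — EL₂ OF EVERY POWER `(1 − τ•A_t)^i`** [folklore]: (a) `‖1 − τ•A_t‖ ≤ q ≤ 1`-free… precisely: `‖1 − τ•A_t‖ ≤ q` with `q ≤ 1` (entries of the powers bounded by
`q^i ≤ 1`, PART 136), (b) window decay of `A_t` with `δ > 0`, (c) EL₂ of `A_t` ⟹ EL₂ of `(1 − τ•A_t)^i` for every `i` (induction: `B^{i+1} = B^i·B`, §1 with the left factor bounded). -/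
theorem tendsto_pow_pair (hside : Tendsto side atTop atTop) {A : (t : ℕ) → Matrix (Site d (side t) × F) (Site d (side t) × F) ℂ} {τ : ℂ} {q C δ : ℝ}
    (hq : ∀ t, ‖1 - τ • A t‖ ≤ q) (hq1 : q ≤ 1)
    (hdec : ∀ t (w : Site d (side t)) (g : F) (y : Site d (side t)) (h : F), ‖A t (w, g) (y, h)‖ ≤ C * Real.exp (-δ * l1 (windowMap d (side t) (w - y)))) (hδ : 0 < δ)
    (hA : ∀ (f g : F) (z z' : Fin d → ℤ), ∃ s : ℂ, Tendsto (fun t => A t (castT (cubic d (side t)) z, f) (castT (cubic d (side t)) z', g)) atTop (𝓝 s))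
    (i : ℕ) (f g : F) (z z' : Fin d → ℤ) :
    ∃ s : ℂ, Tendsto (fun t => ((1 - τ • A t) ^ i : Matrix (Site d (side t) × F) (Site d (side t) × F) ℂ) (castT (cubic d (side t)) z, f) (castT (cubic d (side t)) z', g))
      atTop (𝓝 s) := by
  have hq0 : 0 ≤ q := (norm_nonneg _).trans (hq 0)
  induction i generalizing f g z z' with
  | zero =>
    simp only [pow_zero]
    obtain ⟨s, hs⟩ := tendsto_one_sub_smul_pair (d := d) hside (A := fun t => (0 : Matrix (Site d (side t) × F) (Site d (side t) × F) ℂ)) 0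
      (fun f g z z' => ⟨0, by simp only [Matrix.zero_apply]; exact tendsto_const_nhds⟩) f g z z'
    refine ⟨s, hs.congr fun t => ?_⟩
    simp only [zero_smul, sub_zero]
  | succ i ih =>
    simp only [pow_succ]
    exact tendsto_mul_pair hside (X := fun t => (1 - τ • A t) ^ i) (Y := fun t => 1 - τ • A t)
      (fun t x f' w g' => (norm_pow_apply_le (hq t) i _ _).trans (pow_le_one₀ hq0 hq1))
      (fun t w g' y h' => norm_one_sub_smul_apply_le (side t) τ (hdec t) w g' y h') hδ ih
      (fun f' g' u u' => tendsto_one_sub_smul_pair hside τ hA f' g' u u') f g z z'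

/-- **`exists_tendsto_inv_pair` — INVERSES WITHOUT TRANSLATION INVARIANCE, ANY FINITE FIBRE** [folklore]: along `side t → ∞`, a family `A_t` of matrices on `Site d (side t) × F` with
(a) `‖1 − τ•A_t‖ ≤ q < 1`, (b) `‖A_t((w,g),(y,h))‖ ≤ C·e^{−δ|windowMap(w − y)|₁}` (`δ > 0`, `C ≥ 0`, all `t`), (c) EL₂ of `A_t` ⟹ EL₂ of `A_t⁻¹`: for all `f, g, z, z′`,
`∃ s, (A_t)⁻¹((ẑ_t,f),(ẑ′_t,g)) → s` (`s = τ·Σ' i p_i`, `p_i` the limits of the powers; PART 136's Neumann–Tannery). -/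
theorem exists_tendsto_inv_pair (hside : Tendsto side atTop atTop) {A : (t : ℕ) → Matrix (Site d (side t) × F) (Site d (side t) × F) ℂ} {τ : ℂ} {q C δ : ℝ}
    (hq : ∀ t, ‖1 - τ • A t‖ ≤ q) (hq1 : q < 1)
    (hdec : ∀ t (w : Site d (side t)) (g : F) (y : Site d (side t)) (h : F), ‖A t (w, g) (y, h)‖ ≤ C * Real.exp (-δ * l1 (windowMap d (side t) (w - y)))) (hδ : 0 < δ)
    (hA : ∀ (f g : F) (z z' : Fin d → ℤ), ∃ s : ℂ, Tendsto (fun t => A t (castT (cubic d (side t)) z, f) (castT (cubic d (side t)) z', g)) atTop (𝓝 s))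
    (f g : F) (z z' : Fin d → ℤ) :
    ∃ s : ℂ, Tendsto (fun t => (A t)⁻¹ (castT (cubic d (side t)) z, f) (castT (cubic d (side t)) z', g)) atTop (𝓝 s) := by
  have hpow := fun i => tendsto_pow_pair (d := d) hside hq hq1.le hdec hδ hA i f g z z'
  choose p hp using hpow
  exact ⟨_, (tendsto_inv_apply_of_tendsto_pow_apply hq1 hq (fun t => (castT (cubic d (side t)) z, f)) (fun t => (castT (cubic d (side t)) z', g)) hp).2⟩

end Summit.QuantumFields.BalabanUV.Beta.GAN24.VolumeLimitPairsFibre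

end
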